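import Literature.NumberTheory.ModularForms.PoincareSeriesWeightTwoHeckeSqIntegrable
import Literature.NumberTheory.ModularForms.PoincareSeriesWeightTwoHeckeUnfoldingGeneral
import Literature.NumberTheory.ModularForms.PoincareSeriesWeightTwoFourierModes
import Literature.NumberTheory.ModularForms.PoincareSeriesWeightTwoCellDecay
import Mathlib.Analysis.SpecialFunctions.Gaussian.GaussianIntegral
import HarnessLib

/-!
# The Gram pairings of Hecke's family `yˢ P_m(·,s)`: unfolding to the `m`-th Fourier mode and the
# joint limit `s, s' → 0⁺`

Topic `Literature/NumberTheory/ModularForms` (namespace `Literature.NumberTheory.ModularForms.PoincareWeightTwo`,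
continuing `PoincareSeriesWeightTwoHecke.lean` (definitions), `…HeckeUnfoldingGeneral.lean` (unfolding
against a weight-2 automorphic `G`), `…FourierModes.lean` (T2: the modes of `P_m(·+iy,s)`),
`…HeckeSqIntegrable.lean` (`sup (Im)^{1+s}|P_m| < ∞`) and `…CellDecay.lean` (the cells are
`O(y^{−7/8−s})`)). THEOREMS ONLY; no definition, no named fact.

With `E_s(z) = (Im z)ˢ P_m(z,s)` (Iwaniec–Kowalski §14.1 (14.4) with Hecke's factor, §3.2) and the
tree's Petersson pairing of functions `⟪·,·⟫ = peterssonPairing N 2` (conjugate-linear in the first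
slot), for `m ≥ 1` and every level `N`:

* `integrableOn_seed_strip_of_norm_le` — the unfolding seed `conj(e(mw))(Im w)^{s+2}G(w)` is
  integrable on the strip `{0 ≤ Re < 1}` for every measurable `G = O(1/Im)` (`s > 0`);
* `rpow_im_mul_poincareHecke_smul` — `E_s` obeys the weight-2 law `E_s(γz) = (cz+d)² E_s(z)`,
  `γ ∈ Γ₀(N)` (from T1's weight-`(2,s)` automorphy);
* `peterssonPairing_hecke_eq_integral_fourierMode` — **the Gram pairings unfold to the `m`-th mode**:
  `⟪E_s, E_{s'}⟫ = ∫₀^∞ y^{s+s'} e^{−2πmy} · fourierMode N m s' m y dy` (`s, s' > 0`; Lemma 14.3's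
  unfolding with `f` replaced by `E_{s'}`, then T2);
* `tendsto_gram_peterssonPairing` — **the joint limit**: as `(s,s') → (0⁺,0⁺)`,
  `⟪E_s, E_{s'}⟫ → ∫₀^∞ e^{−2πmy} · fourierMode N m 0 m y dy` (dominated convergence: the diagonal
  part of the mode is `e^{−2πmy}`, the cells are `≤ C y^{−(s'+7/8)}` uniformly (`…CellDecay`), so the
  integrand is `≤ e^{−2πmy}((1+y²) + C(y^{−7/8} + y))`; pointwise limit by
  `tendsto_fourierMode_nhdsGT_zero`).

This is the analytic input of the `L²` form of Hecke's limit (stub T4 `HeckeL2` of the I1 skeleton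
`Summits/Parity/GeneralizedHardyLittlewood/Cruxes/PeterssonBoundPrinted/Lines/poincare_hecke.lean`,
Kowalski–Michel 2000 Petersson formula, stmt-Parity-20404): `‖E_s − E_{s'}‖² = ⟪E_s,E_s⟫ − 2Re⟪E_s,E_{s'}⟫
+ ⟪E_{s'},E_{s'}⟫ → 0`, i.e. the family is Cauchy in `L²(Γ₀(N)\ℍ)`.

## References

* [IwaniecKowalski2004] H. Iwaniec, E. Kowalski, *Analytic Number Theory*, AMS Colloq. Publ. 53,
  Lemma 14.3 (proof: unfolding), Lemma 14.2 (proof: the modes), §3.2 (Hecke's trick).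
* [Iwaniec2002] H. Iwaniec, *Spectral Methods of Automorphic Forms*, §3.2 (3.13), §7.1 (inner products
  of Poincaré series by unfolding).
-/

noncomputable section

open scoped MatrixGroups Real Topology ENNReal NNReal ComplexConjugate
open CongruenceSubgroup Complex MeasureTheory Filter Set
open UpperHalfPlane hiding I
open Literature.NumberTheory.EllipticCurves.ModularForms

namespace Literature.NumberTheory.ModularForms.PoincareWeightTwo

variable {N : ℕ}

/-! ## Integrability of the unfolding seed for `G = O(1/y)` -/

section Seed

/-- The seed is measurable on `ℂ`. [folklore] -/
private theorem measurable_seedG (m : ℕ) (s : ℝ) {G : ℍ → ℂ} (hG : Measurable G) :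
    Measurable (fun z : ℂ ↦ conj (cexp (2 * π * I * m * z)) * ((z.im ^ (s + 2) : ℝ) : ℂ) * G (UpperHalfPlane.ofComplex z)) := by
  refine Measurable.mul (Measurable.mul ?_ ?_) ?_
  · exact (Complex.continuous_conj.measurable.comp
      (Complex.measurable_exp.comp (measurable_const.mul measurable_id)))
  · exact Complex.measurable_ofReal.comp ((Complex.measurable_im).pow_const _)
  · exact hG.comp measurable_ofComplex

/-- `(1/|Im(x + iy)|)² = y⁻²` (`y > 0`). [folklore] -/
private theorem coe_invImSq_mk'' (x : ℝ) {y : ℝ} (hy : 0 < y) :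
    (((1 / ‖(⟨x, y⟩ : ℂ).im‖₊) ^ 2 : ℝ≥0) : ℝ) = (y ^ 2)⁻¹ := by
  push_cast
  rw [Real.norm_of_nonneg hy.le, one_div, inv_pow]

/-- `|conj(e(mz))| = e^{−2πm Im z}`. [folklore] -/
private theorem norm_conj_cexp' (m : ℕ) (z : ℂ) :
    ‖conj (cexp (2 * π * I * m * z))‖ = Real.exp (-(2 * π * m * z.im)) := by
  rw [Complex.norm_conj, Complex.norm_exp]
  congr 1
  simp only [mul_re, mul_im, re_ofNat, im_ofNat, ofReal_re, ofReal_im, Complex.I_re, Complex.I_im,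
    natCast_re, natCast_im]
  ring

/-- **Size of the seed against the invariant density** for `‖G‖ ≤ K/y`:
`y⁻² |h(x+iy)| ≤ K y^{s−1} e^{−2πmy}`. [cite: IwaniecKowalski2004, Lemma 14.3 (proof: absolute convergence)] -/
private theorem norm_invImSq_smul_seedG_le (m : ℕ) (s : ℝ) {G : ℍ → ℂ} {K : ℝ}
    (hK : ∀ w : ℍ, ‖G w‖ ≤ K / w.im) (x : ℝ) {y : ℝ} (hy : 0 < y) :
    ‖((((1 / ‖(⟨x, y⟩ : ℂ).im‖₊) ^ 2 : ℝ≥0) : ℝ)) •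
        ((fun z : ℂ ↦ conj (cexp (2 * π * I * m * z)) * ((z.im ^ (s + 2) : ℝ) : ℂ) * G (UpperHalfPlane.ofComplex z)) ⟨x, y⟩)‖ ≤
      K * (y ^ (s - 1) * Real.exp (-(2 * π * m) * y)) := by
  have hz : 0 < (⟨x, y⟩ : ℂ).im := hy
  have hτ : (UpperHalfPlane.ofComplex ⟨x, y⟩).im = y := by
    rw [UpperHalfPlane.ofComplex_apply_of_im_pos hz]; rfl
  have hf : ‖G (UpperHalfPlane.ofComplex ⟨x, y⟩)‖ ≤ K / y := by
    have := hK (UpperHalfPlane.ofComplex ⟨x, y⟩)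
    rwa [hτ] at this
  have him : (⟨x, y⟩ : ℂ).im = y := rfl
  rw [norm_smul, coe_invImSq_mk'' x hy, norm_mul, norm_mul, norm_conj_cexp', Complex.norm_real, him,
    Real.norm_of_nonneg (Real.rpow_nonneg hy.le _), Real.norm_of_nonneg (by positivity)]
  calc (y ^ 2)⁻¹ * (Real.exp (-(2 * π * m * y)) * y ^ (s + 2) * ‖G (UpperHalfPlane.ofComplex ⟨x, y⟩)‖)
      ≤ (y ^ 2)⁻¹ * (Real.exp (-(2 * π * m * y)) * y ^ (s + 2) * (K / y)) := by
        gcongr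
    _ = K * (y ^ (s - 1) * Real.exp (-(2 * π * m) * y)) := by
        have h3 : y ^ (s + 2) = y ^ (s - 1) * y ^ (3 : ℕ) := by
          rw [← Real.rpow_natCast, ← Real.rpow_add hy]; congr 1; push_cast; ring
        rw [h3, neg_mul]
        field_simp

/-- **The seed is integrable on the strip for `G = O(1/y)`**: for a measurable `G : ℍ → ℂ` with
`‖G(w)‖ ≤ K / Im w`, `m ≥ 1` and `s > 0`, `conj(e(mw)) (Im w)^{s+2} G(w)` is integrable on
`{0 ≤ Re w < 1}` (majorant `K y^{s−1} e^{−2πmy}` against `dx dy/y²`). With `G` a cusp form this is the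
absolute convergence in Iwaniec–Kowalski's Lemma 14.3; here it serves `G = y^{s'}P_m(·,s')`.
[cite: IwaniecKowalski2004, Lemma 14.3 (proof: absolute convergence)] -/
theorem integrableOn_seed_strip_of_norm_le {G : ℍ → ℂ} (hGm : Measurable G) {K : ℝ}
    (hK : ∀ w : ℍ, ‖G w‖ ≤ K / w.im) (m : ℕ) (hm : 1 ≤ m) {s : ℝ} (hs : 0 < s) :
    IntegrableOn (fun w : ℍ ↦ conj (cexp (2 * π * I * m * (w : ℂ))) * ((w.im ^ (s + 2) : ℝ) : ℂ) * G w)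
      {w : ℍ | 0 ≤ w.re ∧ w.re < 1} volume := by
  have hmpos : (0 : ℝ) < 2 * π * m := by
    have : (1 : ℝ) ≤ m := by exact_mod_cast hm
    positivity
  -- the majorant in `y`
  have hI : IntegrableOn (fun y : ℝ ↦ y ^ (s - 1) * Real.exp (-(2 * π * m) * y)) (Ioi 0) := by
    have h := integrableOn_rpow_mul_exp_neg_mul_rpow (s := s - 1) (p := 1) (b := 2 * π * m)
      (by linarith) le_rfl hmpos
    refine h.congr_fun (fun y _ ↦ ?_) measurableSet_Ioi
    simp only [Real.rpow_one]
  have hM : Integrable (fun q : ℝ × ℝ ↦ (K * (q.1 ^ (s - 1) * Real.exp (-(2 * π * m) * q.1))) * (1 : ℝ))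
      ((volume.restrict (Ioi (0 : ℝ))).prod (volume.restrict (Ico (0 : ℝ) 1))) :=
    Integrable.mul_prod (hI.const_mul K) (integrable_const 1)
  have hprod : IntegrableOn
      (fun q : ℝ × ℝ ↦ ((((1 / ‖(⟨q.2, q.1⟩ : ℂ).im‖₊) ^ 2 : ℝ≥0) : ℝ)) •
        ((fun z : ℂ ↦ conj (cexp (2 * π * I * m * z)) * ((z.im ^ (s + 2) : ℝ) : ℂ) * G (UpperHalfPlane.ofComplex z)) ⟨q.2, q.1⟩))
      (Ioi (0 : ℝ) ×ˢ Ico (0 : ℝ) 1) (volume.prod volume) := by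
    rw [IntegrableOn, ← Measure.prod_restrict]
    refine hM.mono' ?_ ?_
    · refine Measurable.aestronglyMeasurable ?_
      have he : Measurable fun q : ℝ × ℝ ↦ (⟨q.2, q.1⟩ : ℂ) :=
        Complex.measurableEquivRealProd.symm.measurable.comp measurable_swap
      exact (measurable_coe_nnreal_real.comp
        (((measurable_const.div Complex.measurable_im.nnnorm).pow_const 2).comp he)).smul
        ((measurable_seedG m s hGm).comp he)
    · rw [Measure.prod_restrict]
      filter_upwards [ae_restrict_mem (measurableSet_Ioi.prod measurableSet_Ico)] with q hq
      rw [mul_one]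
      exact norm_invImSq_smul_seedG_le m s hK q.2 (mem_prod.mp hq).1
  have h := (setIntegral_strip_eq_prod
    (fun z : ℂ ↦ conj (cexp (2 * π * I * m * z)) * ((z.im ^ (s + 2) : ℝ) : ℂ) * G (UpperHalfPlane.ofComplex z))).1.mpr hprod
  refine h.congr_fun (fun w _ ↦ by
    simp only [UpperHalfPlane.ofComplex_apply, UpperHalfPlane.coe_im]) ?_
  exact (measurableSet_le measurable_const UpperHalfPlane.continuous_re.measurable).inter
    (measurableSet_lt UpperHalfPlane.continuous_re.measurable measurable_const)

end Seed

/-! ## The weight-2 law of `E_s = yˢ P_m(·,s)` and its size -/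

section Law

/-- **`E_s = yˢP_m(·,s)` obeys the weight-2 law** under `Γ₀(N)`: `E_s(γz) = (cz+d)² E_s(z)` (T1:
`P_m(γz,s) = (cz+d)²|cz+d|^{2s}P_m(z,s)` and `Im γz = Im z/|cz+d|²`), for every real `s`.
[cite: IwaniecKowalski2004, §14.1 (14.4) with §3.2] -/
theorem rpow_im_mul_poincareHecke_smul [NeZero N] (m : ℕ) (s : ℝ) :
    ∀ γ : SL(2, ℤ), γ ∈ Gamma0 N → ∀ z : ℍ,
      (fun z : ℍ ↦ ((z.im ^ s : ℝ) : ℂ) * poincareHecke N m s z) (γ • z) =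
        (rowDenom ((γ : Matrix (Fin 2) (Fin 2) ℤ) 1) z) ^ 2 *
          (fun z : ℍ ↦ ((z.im ^ s : ℝ) : ℂ) * poincareHecke N m s z) z := by
  intro γ hγ z
  simp only
  rw [poincareHecke_smul m s γ hγ z, ModularGroup.im_smul_eq_div_normSq, ← rowDenom_apply_one_eq_denom,
    Complex.normSq_eq_norm_sq]
  set J : ℂ := rowDenom ((γ : Matrix (Fin 2) (Fin 2) ℤ) 1) z with hJ
  have hJ0 : 0 < ‖J‖ := by
    rw [hJ, rowDenom_apply_one_eq_denom]
    exact norm_pos_iff.mpr (UpperHalfPlane.denom_ne_zero γ z)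
  have hy := z.im_pos
  have hreal : (z.im / ‖J‖ ^ 2) ^ s * ‖J‖ ^ (2 * s) = z.im ^ s := by
    rw [Real.div_rpow hy.le (by positivity), ← Real.rpow_two, ← Real.rpow_mul hJ0.le]
    field_simp
  calc (((z.im / ‖J‖ ^ 2) ^ s : ℝ) : ℂ) * (J ^ 2 * ((‖J‖ ^ (2 * s) : ℝ) : ℂ) * poincareHecke N m s z)
      = J ^ 2 * ((((z.im / ‖J‖ ^ 2) ^ s * ‖J‖ ^ (2 * s) : ℝ) : ℂ) * poincareHecke N m s z) := by
        push_cast; ring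
    _ = J ^ 2 * (((z.im ^ s : ℝ) : ℂ) * poincareHecke N m s z) := by rw [hreal]

/-- The sup bound of `…HeckeSqIntegrable.lean` in the form `‖E_s(z)‖ ≤ K / Im z` (`s > 0`, `m ≥ 1`).
[cite: IwaniecKowalski2004, §14.1 (14.5) with §3.2] -/
theorem exists_norm_rpow_im_mul_poincareHecke_le_div {m : ℕ} (hm : 1 ≤ m) {s : ℝ} (hs : 0 < s) :
    ∃ K : ℝ, 0 ≤ K ∧ ∀ z : ℍ, ‖((z.im ^ s : ℝ) : ℂ) * poincareHecke N m s z‖ ≤ K / z.im := by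
  obtain ⟨K, hK0, hK⟩ := exists_bound_rpow_im_mul_norm_poincareHecke (N := N) hm hs
  refine ⟨K, hK0, fun z ↦ ?_⟩
  have hy := z.im_pos
  rw [le_div_iff₀ hy, norm_mul, Complex.norm_real, Real.norm_of_nonneg (Real.rpow_nonneg hy.le _)]
  calc z.im ^ s * ‖poincareHecke N m s z‖ * z.im = z.im ^ (1 + s) * ‖poincareHecke N m s z‖ := by
        rw [add_comm, Real.rpow_add_one hy.ne']; ring
    _ ≤ K := hK z

end Law

/-! ## The Gram pairings unfold to the `m`-th Fourier mode -/

section Gram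

variable [NeZero N]

/-- **Unfolding of the Gram pairings**: for `m ≥ 1`, `s, s' > 0`,
`⟪E_s, E_{s'}⟫ = ∫₀^∞ y^{s+s'} e^{−2πmy} · fourierMode N m s' m y dy` (Iwaniec–Kowalski, proof of
Lemma 14.3 with `f` replaced by the weight-2 automorphic `E_{s'}`: the seed is integrable since
`E_{s'} = O(1/y)`; the inner integral `∫₀¹ E_{s'}(x+iy)e(−mx)dx = y^{s'}·(m-th mode)` is T2).
[cite: IwaniecKowalski2004, Lemma 14.3 (proof) and Lemma 14.2 (proof)] -/
theorem peterssonPairing_hecke_eq_integral_fourierMode {m : ℕ} (hm : 1 ≤ m) {s s' : ℝ}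
    (hs : 0 < s) (hs' : 0 < s') :
    peterssonPairing N 2 (fun z : ℍ ↦ ((z.im ^ s : ℝ) : ℂ) * poincareHecke N m s z)
        (fun z : ℍ ↦ ((z.im ^ s' : ℝ) : ℂ) * poincareHecke N m s' z) =
      ∫ y in Ioi (0 : ℝ), (((y ^ (s + s') * Real.exp (-(2 * π * m * y))) : ℝ) : ℂ) *
        fourierMode N m s' (m : ℤ) y := by
  set G : ℍ → ℂ := fun z : ℍ ↦ ((z.im ^ s' : ℝ) : ℂ) * poincareHecke N m s' z with hGdef
  obtain ⟨K, -, hK⟩ := exists_norm_rpow_im_mul_poincareHecke_le_div (N := N) hm hs'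
  have hGm : Measurable G := (continuous_rpow_im_mul_poincareHecke m hs').measurable
  have hlaw := rpow_im_mul_poincareHecke_smul (N := N) m s'
  have hint := integrableOn_seed_strip_of_norm_le hGm hK m hm hs
  rw [peterssonPairing_rpow_mul_poincareHecke_eq_setIntegral m s hGm hlaw hint]
  -- read `G` on `ℂ` through `ofComplex`
  set Gc : ℂ → ℂ := fun z ↦ G (UpperHalfPlane.ofComplex z) with hGc_def
  have hGc : ∀ w : ℍ, Gc (w : ℂ) = G w := fun w ↦ by simp only [hGc_def, UpperHalfPlane.ofComplex_apply]
  have hint' : IntegrableOn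
      (fun w : ℍ ↦ conj (cexp (2 * π * I * m * (w : ℂ))) * ((w.im ^ (s + 2) : ℝ) : ℂ) * Gc w)
      {w : ℍ | 0 ≤ w.re ∧ w.re < 1} volume := by
    simp_rw [hGc]; exact hint
  have e1 : ∫ w in {w : ℍ | 0 ≤ w.re ∧ w.re < 1},
      conj (cexp (2 * π * I * m * (w : ℂ))) * ((w.im ^ (s + 2) : ℝ) : ℂ) * G w =
      ∫ w in {w : ℍ | 0 ≤ w.re ∧ w.re < 1},
        conj (cexp (2 * π * I * m * (w : ℂ))) * ((w.im ^ (s + 2) : ℝ) : ℂ) * Gc w := by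
    simp_rw [hGc]
  rw [e1, setIntegral_strip_seed_eq_integral_modes m s Gc hint']
  refine setIntegral_congr_fun measurableSet_Ioi fun y hy ↦ ?_
  rw [mem_Ioi] at hy
  -- the inner integral is `y^{s'}` times the `m`-th mode (T2)
  have hinner : ∫ x in (0 : ℝ)..1, Gc ((x : ℂ) + y * I) * cexp (-(2 * π * I * m * x)) =
      ((y ^ s' : ℝ) : ℂ) * fourierMode N m s' (m : ℤ) y := by
    have hpt : ∀ x : ℝ, Gc ((x : ℂ) + y * I) =
        ((y ^ s' : ℝ) : ℂ) * poincareHecke N m s' (UpperHalfPlane.ofComplex ((x : ℂ) + y * I)) := by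
      intro x
      have him : ((x : ℂ) + y * I).im = y := by simp
      have hpos : 0 < ((x : ℂ) + y * I).im := by rw [him]; exact hy
      simp only [hGc_def, hGdef]
      rw [show (UpperHalfPlane.ofComplex ((x : ℂ) + y * I)).im = y by
        rw [UpperHalfPlane.ofComplex_apply_of_im_pos hpos]; exact him]
    have hfun : (fun x : ℝ ↦ Gc ((x : ℂ) + y * I) * cexp (-(2 * π * I * m * x))) =
        fun x : ℝ ↦ ((y ^ s' : ℝ) : ℂ) *
          (poincareHecke N m s' (UpperHalfPlane.ofComplex ((x : ℂ) + y * I)) *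
            cexp (-(2 * π * I * ((m : ℤ) : ℂ) * x))) := by
      funext x
      rw [hpt, mul_assoc]
      push_cast
      ring
    rw [hfun, intervalIntegral.integral_const_mul, (heckeFourierModes N m hm s' hs' (m : ℤ) y hy).2]
    rfl
  rw [hinner, ← mul_assoc]
  congr 1
  push_cast
  rw [Real.rpow_add hy]
  push_cast
  ring

end Gram

/-! ## The joint limit `(s, s') → (0⁺, 0⁺)` of the Gram pairings -/

section Limit

variable [NeZero N]

/-- `y^k e^{−by}` is integrable on `(0, ∞)` for `k > −1`, `b > 0` (a Gamma integral). [folklore] -/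
private theorem integrableOn_rpow_mul_exp {k b : ℝ} (hk : -1 < k) (hb : 0 < b) :
    IntegrableOn (fun y : ℝ ↦ y ^ k * Real.exp (-(b * y))) (Ioi 0) := by
  have h := integrableOn_rpow_mul_exp_neg_mul_rpow (s := k) (p := 1) hk le_rfl hb
  refine h.congr_fun (fun y _ ↦ ?_) measurableSet_Ioi
  simp only [Real.rpow_one, neg_mul]

/-- For `y > 0`, `0 ≤ a ≤ 2`: `y^a ≤ y⁰ + y²`. [folklore] -/
private theorem rpow_le_one_add_sq {y a : ℝ} (hy : 0 < y) (ha0 : 0 ≤ a) (ha2 : a ≤ 2) :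
    y ^ a ≤ y ^ (0 : ℝ) + y ^ (2 : ℝ) := by
  have h0 : 0 ≤ y ^ (0 : ℝ) := Real.rpow_nonneg hy.le _
  have h2 : 0 ≤ y ^ (2 : ℝ) := Real.rpow_nonneg hy.le _
  rcases le_or_gt y 1 with h | h
  · calc y ^ a ≤ 1 := Real.rpow_le_one hy.le h ha0
      _ = y ^ (0 : ℝ) := (Real.rpow_zero y).symm
      _ ≤ y ^ (0 : ℝ) + y ^ (2 : ℝ) := le_add_of_nonneg_right h2
  · calc y ^ a ≤ y ^ (2 : ℝ) := Real.rpow_le_rpow_of_exponent_le h.le ha2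
      _ ≤ y ^ (0 : ℝ) + y ^ (2 : ℝ) := le_add_of_nonneg_left h0

/-- For `y > 0`, `0 ≤ s ≤ 1`: `y^{s−7/8} ≤ y^{−7/8} + y¹`. [folklore] -/
private theorem rpow_sub_le {y s : ℝ} (hy : 0 < y) (hs0 : 0 ≤ s) (hs1 : s ≤ 1) :
    y ^ (s - 7 / 8) ≤ y ^ (-(7 / 8 : ℝ)) + y ^ (1 : ℝ) := by
  have h0 : 0 ≤ y ^ (-(7 / 8 : ℝ)) := Real.rpow_nonneg hy.le _
  have h1 : 0 ≤ y ^ (1 : ℝ) := Real.rpow_nonneg hy.le _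
  rcases le_or_gt y 1 with h | h
  · calc y ^ (s - 7 / 8) ≤ y ^ (-(7 / 8 : ℝ)) :=
          Real.rpow_le_rpow_of_exponent_ge hy h (by linarith)
      _ ≤ y ^ (-(7 / 8 : ℝ)) + y ^ (1 : ℝ) := le_add_of_nonneg_right h1
  · calc y ^ (s - 7 / 8) ≤ y ^ (1 : ℝ) := Real.rpow_le_rpow_of_exponent_le h.le (by linarith)
      _ ≤ y ^ (-(7 / 8 : ℝ)) + y ^ (1 : ℝ) := le_add_of_nonneg_left h0

/-- **The modes are measurable in `y` on `(0,∞)`** (`s > 0`): by T2 they are parametric integrals over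
`[0,1]` of a measurable function of `(y, x)`. [cite: IwaniecKowalski2004, §14.2 (proof of Lemma 14.2)] -/
theorem aestronglyMeasurable_fourierMode {m : ℕ} (hm : 1 ≤ m) {s : ℝ} (hs : 0 < s) (n : ℤ) :
    AEStronglyMeasurable (fun y : ℝ ↦ fourierMode N m s n y) (volume.restrict (Ioi 0)) := by
  have hF : Measurable (Function.uncurry fun (y x : ℝ) ↦
      poincareHecke N m s (UpperHalfPlane.ofComplex ((x : ℂ) + y * I)) * cexp (-(2 * π * I * n * x))) := by
    have h1 : Measurable fun p : ℝ × ℝ ↦ (p.2 : ℂ) + p.1 * I := by fun_prop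
    have h2 : Continuous fun p : ℝ × ℝ ↦ cexp (-(2 * π * I * n * p.2)) := by fun_prop
    exact ((continuous_poincareHecke m hs).measurable.comp (measurable_ofComplex.comp h1)).mul h2.measurable
  have hSM : StronglyMeasurable fun y : ℝ ↦ ∫ x in Ioc (0 : ℝ) 1,
      poincareHecke N m s (UpperHalfPlane.ofComplex ((x : ℂ) + y * I)) * cexp (-(2 * π * I * n * x)) :=
    hF.stronglyMeasurable.integral_prod_right (ν := volume.restrict (Ioc (0 : ℝ) 1))
  refine (hSM.aestronglyMeasurable.restrict).congr ?_
  filter_upwards [ae_restrict_mem measurableSet_Ioi] with y hy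
  rw [← intervalIntegral.integral_of_le zero_le_one, (heckeFourierModes N m hm s hs n y hy).2]
  rfl

/-- **The joint limit of the Gram pairings**: as `(s, s') → (0⁺, 0⁺)`,
`⟪E_s, E_{s'}⟫ → ∫₀^∞ e^{−2πmy} · fourierMode N m 0 m y dy` (dominated convergence on `(0,∞)`:
the integrand `y^{s+s'}e^{−2πmy}·fourierMode N m s' m y` is bounded by
`e^{−2πmy}((1 + y²) + C(y^{−7/8} + y))` for `s, s' ∈ (0,1]` by the cell decay, and converges
pointwise by the continuity of the modes at `s' = 0⁺`). [cite: IwaniecKowalski2004, §14.2 with §3.2 (Hecke's limit)] -/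
theorem tendsto_gram_peterssonPairing {m : ℕ} (hm : 1 ≤ m) :
    Tendsto (fun p : ℝ × ℝ ↦ peterssonPairing N 2
        (fun z : ℍ ↦ ((z.im ^ p.1 : ℝ) : ℂ) * poincareHecke N m p.1 z)
        (fun z : ℍ ↦ ((z.im ^ p.2 : ℝ) : ℂ) * poincareHecke N m p.2 z))
      (𝓝[>] (0 : ℝ) ×ˢ 𝓝[>] (0 : ℝ))
      (𝓝 (∫ y in Ioi (0 : ℝ), ((Real.exp (-(2 * π * m * y)) : ℝ) : ℂ) * fourierMode N m 0 (m : ℤ) y)) := by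
  obtain ⟨C, hC0, hC⟩ := exists_norm_tsum_cellTerm_le N hm
  have hb : (0 : ℝ) < 2 * π * m := by
    have : (1 : ℝ) ≤ m := by exact_mod_cast hm
    positivity
  -- eventually `(s, s') ∈ (0,1]²`
  have hev : ∀ᶠ p : ℝ × ℝ in 𝓝[>] (0 : ℝ) ×ˢ 𝓝[>] (0 : ℝ), p ∈ Ioc (0 : ℝ) 1 ×ˢ Ioc (0 : ℝ) 1 :=
    Filter.prod_mem_prod (Ioc_mem_nhdsGT one_pos) (Ioc_mem_nhdsGT one_pos)
  -- the integrands
  set F : ℝ × ℝ → ℝ → ℂ := fun p y ↦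
    (((y ^ (p.1 + p.2) * Real.exp (-(2 * π * m * y))) : ℝ) : ℂ) * fourierMode N m p.2 (m : ℤ) y with hFdef
  have heq : (fun p : ℝ × ℝ ↦ ∫ y in Ioi (0 : ℝ), F p y) =ᶠ[𝓝[>] (0 : ℝ) ×ˢ 𝓝[>] (0 : ℝ)]
      fun p : ℝ × ℝ ↦ peterssonPairing N 2
        (fun z : ℍ ↦ ((z.im ^ p.1 : ℝ) : ℂ) * poincareHecke N m p.1 z)
        (fun z : ℍ ↦ ((z.im ^ p.2 : ℝ) : ℂ) * poincareHecke N m p.2 z) := by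
    filter_upwards [hev] with p hp
    exact (peterssonPairing_hecke_eq_integral_fourierMode hm hp.1.1 hp.2.1).symm
  refine Tendsto.congr' heq ?_
  -- dominated convergence
  set bound : ℝ → ℝ := fun y ↦
    (y ^ (0 : ℝ) * Real.exp (-(2 * π * m * y)) + y ^ (2 : ℝ) * Real.exp (-(2 * π * m * y))) +
      C * (y ^ (-(7 / 8 : ℝ)) * Real.exp (-(2 * π * m * y)) + y ^ (1 : ℝ) * Real.exp (-(2 * π * m * y)))
    with hbound
  refine tendsto_integral_filter_of_dominated_convergence bound ?_ ?_ ?_ ?_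
  · -- measurability
    filter_upwards [hev] with p hp
    have hc : Continuous fun y : ℝ ↦ (((y ^ (p.1 + p.2) * Real.exp (-(2 * π * m * y))) : ℝ) : ℂ) :=
      Complex.continuous_ofReal.comp
        ((Real.continuous_rpow_const (by linarith [hp.1.1, hp.2.1])).mul (by fun_prop))
    exact hc.aestronglyMeasurable.mul (aestronglyMeasurable_fourierMode hm hp.2.1 _)
  · -- domination on `(0,1]²`
    filter_upwards [hev] with p hp
    obtain ⟨⟨hs0, hs1⟩, ⟨hs0', hs1'⟩⟩ := hp
    refine (ae_restrict_iff' measurableSet_Ioi).mpr (ae_of_all _ fun y (hy : 0 < y) ↦ ?_)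
    have hexp : 0 < Real.exp (-(2 * π * m * y)) := Real.exp_pos _
    obtain ⟨-, hcell⟩ := hC p.2 hs0'.le hs1' (m : ℤ) y hy
    -- the mode: diagonal term `≤ 1`, cells `≤ C y^{−(s'+7/8)}`
    have hδ : ‖(if ((m : ℤ)) = (m : ℤ) then cexp (-(2 * π * m * y)) else 0 : ℂ)‖ ≤ 1 := by
      rw [if_pos rfl, Complex.norm_exp]
      refine Real.exp_le_one_iff.mpr ?_
      have : (-(2 * π * (m : ℂ) * (y : ℂ))).re = -(2 * π * m * y) := by simp [Complex.mul_re]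
      rw [this, neg_nonpos]
      positivity
    have hmode : ‖fourierMode N m p.2 (m : ℤ) y‖ ≤ 1 + C * y ^ (-(p.2 + 7 / 8)) := by
      unfold fourierMode
      exact (norm_add_le _ _).trans (add_le_add hδ hcell)
    have hya : y ^ (p.1 + p.2) ≤ y ^ (0 : ℝ) + y ^ (2 : ℝ) :=
      rpow_le_one_add_sq hy (by linarith) (by linarith)
    have hyb : y ^ (p.1 + p.2) * y ^ (-(p.2 + 7 / 8)) ≤ y ^ (-(7 / 8 : ℝ)) + y ^ (1 : ℝ) := by
      rw [← Real.rpow_add hy, show p.1 + p.2 + -(p.2 + 7 / 8) = p.1 - 7 / 8 by ring]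
      exact rpow_sub_le hy hs0.le hs1
    simp only [hFdef]
    rw [norm_mul, Complex.norm_real, Real.norm_of_nonneg (by positivity)]
    calc y ^ (p.1 + p.2) * Real.exp (-(2 * π * m * y)) * ‖fourierMode N m p.2 (m : ℤ) y‖
        ≤ y ^ (p.1 + p.2) * Real.exp (-(2 * π * m * y)) * (1 + C * y ^ (-(p.2 + 7 / 8))) := by
          gcongr
      _ = Real.exp (-(2 * π * m * y)) * (y ^ (p.1 + p.2) + C * (y ^ (p.1 + p.2) * y ^ (-(p.2 + 7 / 8)))) := by
          ring
      _ ≤ Real.exp (-(2 * π * m * y)) * ((y ^ (0 : ℝ) + y ^ (2 : ℝ)) + C * (y ^ (-(7 / 8 : ℝ)) + y ^ (1 : ℝ))) := by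
          gcongr
      _ = bound y := by simp only [hbound]; ring
  · -- the dominating function is integrable
    simp only [hbound]
    exact ((integrableOn_rpow_mul_exp (by norm_num) hb).add (integrableOn_rpow_mul_exp (by norm_num) hb)).add
      (((integrableOn_rpow_mul_exp (by norm_num) hb).add (integrableOn_rpow_mul_exp (by norm_num) hb)).const_mul C)
  · -- pointwise limit
    refine (ae_restrict_iff' measurableSet_Ioi).mpr (ae_of_all _ fun y (hy : 0 < y) ↦ ?_)
    have hsum : Tendsto (fun p : ℝ × ℝ ↦ p.1 + p.2) (𝓝[>] (0 : ℝ) ×ˢ 𝓝[>] (0 : ℝ)) (𝓝 0) := by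
      have h : Tendsto (fun p : ℝ × ℝ ↦ p.1 + p.2) (𝓝 ((0 : ℝ), (0 : ℝ))) (𝓝 ((0 : ℝ) + 0)) :=
        ((continuous_fst.add continuous_snd).tendsto _)
      rw [add_zero, nhds_prod_eq] at h
      exact h.mono_left (Filter.prod_mono nhdsWithin_le_nhds nhdsWithin_le_nhds)
    have hpow : Tendsto (fun p : ℝ × ℝ ↦ y ^ (p.1 + p.2)) (𝓝[>] (0 : ℝ) ×ˢ 𝓝[>] (0 : ℝ)) (𝓝 1) := by
      have hc := ((Real.continuous_const_rpow hy.ne').tendsto 0).comp hsum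
      rwa [Function.comp_def, Real.rpow_zero] at hc
    have hscal : Tendsto (fun p : ℝ × ℝ ↦ (((y ^ (p.1 + p.2) * Real.exp (-(2 * π * m * y))) : ℝ) : ℂ))
        (𝓝[>] (0 : ℝ) ×ˢ 𝓝[>] (0 : ℝ)) (𝓝 (((1 * Real.exp (-(2 * π * m * y)) : ℝ) : ℂ))) :=
      (Complex.continuous_ofReal.tendsto _).comp (hpow.mul tendsto_const_nhds)
    have hmode : Tendsto (fun p : ℝ × ℝ ↦ fourierMode N m p.2 (m : ℤ) y)
        (𝓝[>] (0 : ℝ) ×ˢ 𝓝[>] (0 : ℝ)) (𝓝 (fourierMode N m 0 (m : ℤ) y)) :=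
      (tendsto_fourierMode_nhdsGT_zero hm (m : ℤ) hy).comp tendsto_snd
    have := hscal.mul hmode
    simpa only [hFdef, one_mul] using this

/-- The joint limit of the REAL parts of the Gram pairings (the form used by the `L²` assembly).
[cite: IwaniecKowalski2004, §14.2 with §3.2 (Hecke's limit)] -/
theorem tendsto_gram_peterssonPairing_re {m : ℕ} (hm : 1 ≤ m) :
    Tendsto (fun p : ℝ × ℝ ↦ (peterssonPairing N 2
        (fun z : ℍ ↦ ((z.im ^ p.1 : ℝ) : ℂ) * poincareHecke N m p.1 z)
        (fun z : ℍ ↦ ((z.im ^ p.2 : ℝ) : ℂ) * poincareHecke N m p.2 z)).re)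
      (𝓝[>] (0 : ℝ) ×ˢ 𝓝[>] (0 : ℝ))
      (𝓝 (∫ y in Ioi (0 : ℝ), ((Real.exp (-(2 * π * m * y)) : ℝ) : ℂ) * fourierMode N m 0 (m : ℤ) y).re) :=
  (Complex.continuous_re.tendsto _).comp (tendsto_gram_peterssonPairing hm)

end Limit

end Literature.NumberTheory.ModularForms.PoincareWeightTwo

end
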